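import Mathlib
import Summits.Ventures.PercRepro2.ZMeanProof
import Summits.Ventures.PercRepro2.PendantRoot
import Summits.Ventures.PercRepro2.PocketTransport
import Summits.Ventures.PercRepro2.StarGlue
import Summits.Ventures.PercRepro2.StarOEvents

/-!
# The three-coin star at `a₃` (class O): probabilities over the coin outcomes and the first mass
(blind cell PercRepro2, night-1 g8; NIGHT1-G8.md §4; part 1 = `StarOEvents.lean`)

The eight coin outcomes `outc b₁ b₂ b₃` partition the space (`prob_eq_sum_outc`); an event seen
through the closed star (`viaStar A = {ω | closeStar ω ∈ A}`) is free of every star edge, so on an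
outcome it factorises into the coin weights times its probability (`prob_inter_outc`), which is
the probability of `A` under the star-zeroed weights `pOut` (`prob_viaStar`, PocketTransport).
THE FIRST MASS: `P(Q) = (1−α)(1−β)Z₁ + α(1−β)(Z₁ − rA_H) + β(1−α)(Z₁ − rA_L)` with
`Z₁ = P_{pOut}(Q)`, `A_x = P_{pOut}(Q, o ∈ C_x)` (`prob_Q_star`) — the pattern for the remaining
twelve masses of NIGHT1-G8.md §4 (`zMass` of StarOAlgebra).
-/

namespace Summit.Ventures.PercRepro2

open StarGlue PendantRoot

namespace StarO

variable {V : Type*} {E : Type*} [Fintype E] [DecidableEq E] [Fintype V] [DecidableEq V]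
  {R : Type*} [Field R] [LinearOrder R] [IsStrictOrderedRing R]

section Infra

variable (p : E → R) (ends : E → Sym2 V) (a₃ : V)

/-- The star-zeroed weights. -/
noncomputable def pOut : E → R := PocketConn.zeroOn (touches ends {a₃}).toFinset p

/-- An event seen through the closed star. -/
def viaStar (A : Set (Config E)) : Set (Config E) := {ω | closeStar ends a₃ ω ∈ A}

/-- The coin outcome `{ω f₁ = b₁, ω f₂ = b₂, ω f₃ = b₃}`. -/
def outc (f₁ f₂ f₃ : E) (b₁ b₂ b₃ : Bool) : Set (Config E) :=
  {ω | ω f₁ = b₁ ∧ ω f₂ = b₂ ∧ ω f₃ = b₃}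

/-- The weight of a coin value. -/
def cw (b : Bool) (q : R) : R := if b then q else 1 - q

omit [Fintype E] [DecidableEq E] [Fintype V] [DecidableEq V] [LinearOrder R] [IsStrictOrderedRing R] in
/-- Membership in an outcome. -/
lemma mem_outc {f₁ f₂ f₃ : E} {b₁ b₂ b₃ : Bool} {ω : Config E} :
    ω ∈ outc f₁ f₂ f₃ b₁ b₂ b₃ ↔ ω f₁ = b₁ ∧ ω f₂ = b₂ ∧ ω f₃ = b₃ := Iff.rfl

omit [LinearOrder R] [IsStrictOrderedRing R] in
/-- **Transport**: `P(viaStar A) = P_{pOut}(A)`. -/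
lemma prob_viaStar (A : Set (Config E)) : prob p (viaStar ends a₃ A) = prob (pOut p ends a₃) A := by
  unfold viaStar pOut
  exact PocketConn.prob_restrict_compl_eq (touches ends {a₃}) p (· ∈ A)

omit [Fintype E] [DecidableEq E] [LinearOrder R] [IsStrictOrderedRing R] in
/-- `viaStar A` is free of every star edge. -/
lemma free_viaStar {f : E} (hf : a₃ ∈ ends f) (A : Set (Config E)) : Free f (viaStar ends a₃ A) := by
  intro ω ω' h
  have : closeStar ends a₃ ω = closeStar ends a₃ ω' := by
    apply restrict_congr
    intro e he
    have hne : e ≠ f := fun h' => he (by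
      subst h'
      obtain ⟨y, hy⟩ := Sym2.mem_iff_exists.1 hf
      exact ⟨a₃, Set.mem_singleton _, y, hy⟩)
    exact h e hne
  show (closeStar ends a₃ ω ∈ A) = (closeStar ends a₃ ω' ∈ A)
  rw [this]

omit [Fintype E] [DecidableEq E] [Fintype V] [DecidableEq V] [LinearOrder R] [IsStrictOrderedRing R] in
/-- `{ω f = b}` as an edge event. -/
lemma coin_eq (f : E) (b : Bool) :
    {ω : Config E | ω f = b} = if b then openEdge f else closedEdge f := by
  cases b <;> rfl

omit [Fintype V] [DecidableEq V] [LinearOrder R] [IsStrictOrderedRing R] in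
/-- A free event factorises against one coin. -/
lemma prob_inter_coin {f : E} {A : Set (Config E)} (hA : Free f A) (b : Bool) :
    prob p (A ∩ {ω | ω f = b}) = prob p A * cw b (p f) := by
  rw [coin_eq]
  cases b
  · simp only [Bool.false_eq_true, ↓reduceIte, cw]
    exact prob_inter_closedEdge_of_free p hA
  · simp only [↓reduceIte, cw]
    exact prob_inter_openEdge_of_free p hA

omit [Fintype E] [DecidableEq E] [Fintype V] [DecidableEq V] [LinearOrder R] [IsStrictOrderedRing R] in
/-- A coin event at `f'` is free of `f ≠ f'`. -/
lemma free_coin_of_ne {f f' : E} (h : f ≠ f') (b : Bool) : Free f {ω : Config E | ω f' = b} := by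
  intro ω ω' hω
  show (ω f' = b) = (ω' f' = b)
  rw [hω f' (Ne.symm h)]

omit [Fintype V] [DecidableEq V] [LinearOrder R] [IsStrictOrderedRing R] in
/-- **Factorisation on an outcome**: for `A` free of the three star edges,
`P(A ∩ outc b) = P(A) · cw b₁ · cw b₂ · cw b₃`. -/
lemma prob_inter_outc {f₁ f₂ f₃ : E} (h12 : f₁ ≠ f₂) (h13 : f₁ ≠ f₃) (h23 : f₂ ≠ f₃)
    {A : Set (Config E)} (h1 : Free f₁ A) (h2 : Free f₂ A) (h3 : Free f₃ A) (b₁ b₂ b₃ : Bool) :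
    prob p (A ∩ outc f₁ f₂ f₃ b₁ b₂ b₃) =
      prob p A * cw b₁ (p f₁) * cw b₂ (p f₂) * cw b₃ (p f₃) := by
  have e : A ∩ outc f₁ f₂ f₃ b₁ b₂ b₃ =
      ((A ∩ {ω | ω f₁ = b₁}) ∩ {ω | ω f₂ = b₂}) ∩ {ω | ω f₃ = b₃} := by
    ext ω; simp only [Set.mem_inter_iff, mem_outc, Set.mem_setOf_eq]; tauto
  rw [e, prob_inter_coin p ((h3.inter (free_coin_of_ne h13.symm b₁)).inter
    (free_coin_of_ne h23.symm b₂)) b₃, prob_inter_coin p (h2.inter (free_coin_of_ne h12.symm b₁)) b₂,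
    prob_inter_coin p h1 b₁]

omit [Fintype V] [DecidableEq V] [LinearOrder R] [IsStrictOrderedRing R] in
/-- **The outcomes partition the space.** -/
lemma prob_eq_sum_outc (f₁ f₂ f₃ : E) (A : Set (Config E)) :
    prob p A = ∑ b₁ : Bool, ∑ b₂ : Bool, ∑ b₃ : Bool, prob p (A ∩ outc f₁ f₂ f₃ b₁ b₂ b₃) := by
  have h1 : ∀ (B : Set (Config E)) (f : E),
      prob p B = ∑ b : Bool, prob p (B ∩ {ω | ω f = b}) := by
    intro B f
    rw [Fintype.sum_bool]
    have := prob_inter_add_prob_inter_compl p B (openEdge f)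
    rw [← this]
    have hc : {ω : Config E | ω f = false} = (openEdge f)ᶜ := by
      ext ω; simp [openEdge]
    rw [hc]
    rfl
  rw [h1 A f₁]
  refine Finset.sum_congr rfl fun b₁ _ => ?_
  rw [h1 (A ∩ {ω | ω f₁ = b₁}) f₂]
  refine Finset.sum_congr rfl fun b₂ _ => ?_
  rw [h1 (A ∩ {ω | ω f₁ = b₁} ∩ {ω | ω f₂ = b₂}) f₃]
  refine Finset.sum_congr rfl fun b₃ _ => ?_
  congr 1
  ext ω; simp only [Set.mem_inter_iff, Set.mem_setOf_eq, mem_outc]; tauto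

end Infra

end StarO


namespace StarO

section MassQ

variable {V : Type*} {E : Type*} [Fintype E] [DecidableEq E] [Fintype V] [DecidableEq V]
  {R : Type*} [Field R] [LinearOrder R] [IsStrictOrderedRing R]

variable (p : E → R) (ends : E → Sym2 V) {f₁ f₂ f₃ : E} {a₃ a₁ a₂ o : V}

omit [Fintype E] [DecidableEq E] in
/-- `Q ∩ outc` on a single-glue outcome (at most one coin open). -/
lemma Q_inter_outc_single (hf₁ : ends f₁ = s(a₃, a₁)) (hf₂ : ends f₂ = s(a₃, a₂))
    (hf₃ : ends f₃ = s(a₃, o)) (hstar : ∀ e, a₃ ∈ ends e → e = f₁ ∨ e = f₂ ∨ e = f₃)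
    (h31 : a₃ ≠ a₁) (h32 : a₃ ≠ a₂) (h3o : a₃ ≠ o) {b₁ b₂ b₃ : Bool}
    (hb1 : ¬ (b₁ = true ∧ b₂ = true)) (hb2 : ¬ (b₁ = true ∧ b₃ = true))
    (hb3 : ¬ (b₂ = true ∧ b₃ = true)) :
    avoidAll ends a₂ {a₁} ∩ outc f₁ f₂ f₃ b₁ b₂ b₃ =
      viaStar ends a₃ (avoidAll ends a₂ {a₁}) ∩ outc f₁ f₂ f₃ b₁ b₂ b₃ := by
  ext ω
  simp only [Set.mem_inter_iff, mem_outc, viaStar, Set.mem_setOf_eq, avoidAll_eq_compl,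
    Set.mem_compl_iff, mem_connEvent]
  constructor
  · rintro ⟨hQ, h1, h2, h3⟩
    refine ⟨fun h => hQ ?_, h1, h2, h3⟩
    rw [conn_iff_single hf₁ hf₂ hf₃ hstar h31 h32 h3o (by rw [h1, h2]; exact hb1)
      (by rw [h1, h3]; exact hb2) (by rw [h2, h3]; exact hb3) h31.symm h32.symm]
    exact h
  · rintro ⟨hQ, h1, h2, h3⟩
    refine ⟨fun h => hQ ?_, h1, h2, h3⟩
    rw [conn_iff_single hf₁ hf₂ hf₃ hstar h31 h32 h3o (by rw [h1, h2]; exact hb1)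
      (by rw [h1, h3]; exact hb2) (by rw [h2, h3]; exact hb3) h31.symm h32.symm] at h
    exact h
omit [Fintype E] [DecidableEq E] in
/-- `Q ∩ outc` with `f₁, f₃` open: `Q₁` and `o ↮ a₂`. -/
lemma Q_inter_outc_13 (hf₁ : ends f₁ = s(a₃, a₁)) (hf₂ : ends f₂ = s(a₃, a₂))
    (hf₃ : ends f₃ = s(a₃, o)) (hstar : ∀ e, a₃ ∈ ends e → e = f₁ ∨ e = f₂ ∨ e = f₃)
    (h31 : a₃ ≠ a₁) (h32 : a₃ ≠ a₂) (h3o : a₃ ≠ o) :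
    avoidAll ends a₂ {a₁} ∩ outc f₁ f₂ f₃ true false true =
      viaStar ends a₃ (avoidAll ends a₂ {a₁} ∩ (connEvent ends a₂ o)ᶜ) ∩
        outc f₁ f₂ f₃ true false true := by
  ext ω
  simp only [Set.mem_inter_iff, mem_outc, viaStar, Set.mem_setOf_eq, avoidAll_eq_compl,
    Set.mem_compl_iff, mem_connEvent]
  constructor
  · rintro ⟨hQ, h1, h2, h3⟩
    rw [conn_iff_glue13 hf₁ hf₂ hf₃ hstar h31 h32 h3o h1 h2 h3 h31.symm h32.symm] at hQ
    push Not at hQ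
    exact ⟨⟨hQ.1, fun h => hQ.2.1 (conn_refl _ _ _) (conn_symm h)⟩, h1, h2, h3⟩
  · rintro ⟨⟨hQ, ho⟩, h1, h2, h3⟩
    refine ⟨?_, h1, h2, h3⟩
    rw [conn_iff_glue13 hf₁ hf₂ hf₃ hstar h31 h32 h3o h1 h2 h3 h31.symm h32.symm]
    rintro (h | ⟨_, h⟩ | ⟨_, h⟩)
    · exact hQ h
    · exact ho (conn_symm h)
    · exact hQ h

omit [Fintype E] [DecidableEq E] in
/-- `Q ∩ outc` with `f₂, f₃` open: `Q₁` and `o ↮ a₁`. -/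
lemma Q_inter_outc_23 (hf₁ : ends f₁ = s(a₃, a₁)) (hf₂ : ends f₂ = s(a₃, a₂))
    (hf₃ : ends f₃ = s(a₃, o)) (hstar : ∀ e, a₃ ∈ ends e → e = f₁ ∨ e = f₂ ∨ e = f₃)
    (h31 : a₃ ≠ a₁) (h32 : a₃ ≠ a₂) (h3o : a₃ ≠ o) :
    avoidAll ends a₂ {a₁} ∩ outc f₁ f₂ f₃ false true true =
      viaStar ends a₃ (avoidAll ends a₂ {a₁} ∩ (connEvent ends a₁ o)ᶜ) ∩
        outc f₁ f₂ f₃ false true true := by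
  ext ω
  simp only [Set.mem_inter_iff, mem_outc, viaStar, Set.mem_setOf_eq, avoidAll_eq_compl,
    Set.mem_compl_iff, mem_connEvent]
  constructor
  · rintro ⟨hQ, h1, h2, h3⟩
    rw [conn_iff_glue23 hf₁ hf₂ hf₃ hstar h31 h32 h3o h1 h2 h3 h31.symm h32.symm] at hQ
    push Not at hQ
    exact ⟨⟨hQ.1, fun h => hQ.2.2 h (conn_refl _ _ _)⟩, h1, h2, h3⟩
  · rintro ⟨⟨hQ, ho⟩, h1, h2, h3⟩
    refine ⟨?_, h1, h2, h3⟩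
    rw [conn_iff_glue23 hf₁ hf₂ hf₃ hstar h31 h32 h3o h1 h2 h3 h31.symm h32.symm]
    rintro (h | ⟨h, _⟩ | ⟨h, _⟩)
    · exact hQ h
    · exact hQ h
    · exact ho h

omit [Fintype E] [DecidableEq E] [Fintype V] [DecidableEq V] in
/-- `Q ∩ outc` with both root coins open is empty. -/
lemma Q_inter_outc_12 (hf₁ : ends f₁ = s(a₃, a₁)) (hf₂ : ends f₂ = s(a₃, a₂)) (b₃ : Bool) :
    avoidAll ends a₂ {a₁} ∩ outc f₁ f₂ f₃ true true b₃ = ∅ := by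
  ext ω
  simp only [Set.mem_inter_iff, mem_outc, avoidAll_eq_compl, Set.mem_compl_iff, mem_connEvent,
    Set.mem_empty_iff_false, iff_false, not_and]
  intro hQ h1 h2 _
  exact hQ (conn_trans (conn_symm (conn_of_openAdj ⟨f₁, h1, hf₁⟩)) (conn_of_openAdj ⟨f₂, h2, hf₂⟩))

omit [Fintype E] [DecidableEq E] [Fintype V] [DecidableEq V] in
/-- The star edges are distinct when their far ends are. -/
lemma star_edges_ne (hf₁ : ends f₁ = s(a₃, a₁)) (hf₂ : ends f₂ = s(a₃, a₂)) (hf₃ : ends f₃ = s(a₃, o))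
    (h12 : a₁ ≠ a₂) (h1o : a₁ ≠ o) (h2o : a₂ ≠ o) (h31 : a₃ ≠ a₁) (h32 : a₃ ≠ a₂) :
    f₁ ≠ f₂ ∧ f₁ ≠ f₃ ∧ f₂ ≠ f₃ := by
  refine ⟨fun h => ?_, fun h => ?_, fun h => ?_⟩
  · rw [h, hf₂] at hf₁; exact h12 (end_eq_of_ends_eq h31 hf₁.symm).symm
  · rw [h, hf₃] at hf₁; exact h1o (end_eq_of_ends_eq h31 hf₁.symm).symm
  · rw [h, hf₃] at hf₂; exact h2o (end_eq_of_ends_eq h32 hf₂.symm).symm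

/-- **`P(Q)` at the three-coin star**:
`P(Q) = (1−α)(1−β) Z₁ + α(1−β)(Z₁ − r A_H) + β(1−α)(Z₁ − r A_L)` (the `zMass` of StarOAlgebra). -/
theorem prob_Q_star (hf₁ : ends f₁ = s(a₃, a₁)) (hf₂ : ends f₂ = s(a₃, a₂))
    (hf₃ : ends f₃ = s(a₃, o)) (hstar : ∀ e, a₃ ∈ ends e → e = f₁ ∨ e = f₂ ∨ e = f₃)
    (h31 : a₃ ≠ a₁) (h32 : a₃ ≠ a₂) (h3o : a₃ ≠ o) (h12 : f₁ ≠ f₂) (h13 : f₁ ≠ f₃) (h23 : f₂ ≠ f₃) :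
    prob p (avoidAll ends a₂ {a₁}) =
      (1 - p f₁) * (1 - p f₂) * prob (pOut p ends a₃) (avoidAll ends a₂ {a₁}) +
        p f₁ * (1 - p f₂) * (prob (pOut p ends a₃) (avoidAll ends a₂ {a₁}) -
          p f₃ * prob (pOut p ends a₃) (avoidAll ends a₂ {a₁} ∩ connEvent ends a₂ o)) +
        p f₂ * (1 - p f₁) * (prob (pOut p ends a₃) (avoidAll ends a₂ {a₁}) -
          p f₃ * prob (pOut p ends a₃) (avoidAll ends a₂ {a₁} ∩ connEvent ends a₁ o)) := by
  have hf1 : a₃ ∈ ends f₁ := by rw [hf₁]; exact Sym2.mem_mk_left _ _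
  have hf2 : a₃ ∈ ends f₂ := by rw [hf₂]; exact Sym2.mem_mk_left _ _
  have hf3 : a₃ ∈ ends f₃ := by rw [hf₃]; exact Sym2.mem_mk_left _ _
  have fac : ∀ (A : Set (Config E)) (b₁ b₂ b₃ : Bool),
      prob p (viaStar ends a₃ A ∩ outc f₁ f₂ f₃ b₁ b₂ b₃) =
        prob (pOut p ends a₃) A * cw b₁ (p f₁) * cw b₂ (p f₂) * cw b₃ (p f₃) := by
    intro A b₁ b₂ b₃
    rw [prob_inter_outc p h12 h13 h23 (free_viaStar ends a₃ hf1 A) (free_viaStar ends a₃ hf2 A)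
      (free_viaStar ends a₃ hf3 A), prob_viaStar]
  have hAH : prob (pOut p ends a₃) (avoidAll ends a₂ {a₁} ∩ (connEvent ends a₂ o)ᶜ) =
      prob (pOut p ends a₃) (avoidAll ends a₂ {a₁}) -
        prob (pOut p ends a₃) (avoidAll ends a₂ {a₁} ∩ connEvent ends a₂ o) := by
    have := prob_inter_add_prob_inter_compl (pOut p ends a₃) (avoidAll ends a₂ {a₁})
      (connEvent ends a₂ o)
    linarith
  have hAL : prob (pOut p ends a₃) (avoidAll ends a₂ {a₁} ∩ (connEvent ends a₁ o)ᶜ) =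
      prob (pOut p ends a₃) (avoidAll ends a₂ {a₁}) -
        prob (pOut p ends a₃) (avoidAll ends a₂ {a₁} ∩ connEvent ends a₁ o) := by
    have := prob_inter_add_prob_inter_compl (pOut p ends a₃) (avoidAll ends a₂ {a₁})
      (connEvent ends a₁ o)
    linarith
  rw [prob_eq_sum_outc p f₁ f₂ f₃]
  simp only [Fintype.sum_bool]
  rw [Q_inter_outc_12 ends hf₁ hf₂ true, Q_inter_outc_12 ends hf₁ hf₂ false,
    Q_inter_outc_13 ends hf₁ hf₂ hf₃ hstar h31 h32 h3o,
    Q_inter_outc_23 ends hf₁ hf₂ hf₃ hstar h31 h32 h3o,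
    Q_inter_outc_single ends hf₁ hf₂ hf₃ hstar h31 h32 h3o (b₁ := true) (b₂ := false) (b₃ := false)
      (by simp) (by simp) (by simp),
    Q_inter_outc_single ends hf₁ hf₂ hf₃ hstar h31 h32 h3o (b₁ := false) (b₂ := true) (b₃ := false)
      (by simp) (by simp) (by simp),
    Q_inter_outc_single ends hf₁ hf₂ hf₃ hstar h31 h32 h3o (b₁ := false) (b₂ := false) (b₃ := true)
      (by simp) (by simp) (by simp),
    Q_inter_outc_single ends hf₁ hf₂ hf₃ hstar h31 h32 h3o (b₁ := false) (b₂ := false) (b₃ := false)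
      (by simp) (by simp) (by simp),
    fac, fac, fac, fac, fac, fac, prob_empty, hAH, hAL]
  simp only [cw, ↓reduceIte, Bool.false_eq_true]
  ring

end MassQ

end StarO

end Summit.Ventures.PercRepro2
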